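import Summits.BirchSwinnertonDyer.BirchSwinnertonDyer.Theses.KatoDescentPotSupersingular
import Summits.BirchSwinnertonDyer.BirchSwinnertonDyer.Theorems.KatoDescentPotSupersingularMemberHullZetaInputsOfCore
import Summits.BirchSwinnertonDyer.BirchSwinnertonDyer.Theorems.KatoDescentPotSupersingularReducibleKatoMemberZetaInputsDescent
import HarnessLib

/-!
# Route `KatoDescentPotSupersingular` (rung K9, cell `bsd-potss`): the gen-4 GLUE of the shared crux M `ReducibleKatoMember`
# (item stmt-BirchSwinnertonDyer-19196) — item stmt-BirchSwinnertonDyer-28004 (gen 5; gen-4 id 27991 retired) `ReducibleKatoMemberOfCoreInputs`, BY NAME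
# (planner g28 TARGET R265 resplit on K9, 2026-08-28T13:54Z, re-rendered gen 5 at 14:01Z with the ASIDE child
# `PublishedInputMemberHullZetaInputsNamed` as a fourth (unused) glue hypothesis — glue item stmt-BirchSwinnertonDyer-28004; seat `bsd-potss-rkm` g22)

WHAT.  `wildReducibleKatoMemberOfCoreInputs_glue : ReducibleKatoMemberOfCoreInputs` — the K9 route decl VERBATIM, i.e. (gen 5)
`PublishedInputsModularityGZK → PublishedInputMemberHullZetaCore → HeldPoitouTateSelmerDualityQ → PublishedInputMemberHullZetaInputsNamed →
ReducibleKatoMember`: the K9-own bundle «modularity ∧ Gross–Zagier–Kolyvagin», Kato's CORE member package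
`Kato2004.exists_memberHullZetaCoreInputs` (p630270; (b′) zeta-line index at `p` in the pairing form, (c2′) the order of `𝐇²/X𝐇²`) and
Poitou–Tate duality for Selmer structures over `ℚ` ⟹ crux M; the fourth hypothesis (the aside re-statement of the superseded zeta package,
`PublishedInputMemberHullZetaInputsNamed`) is NOT used.  The aliases unfold by
`rfl`; the proof is seat rkm g21's composition: the core fact gives the zeta fact
(`MemberHullZetaInputsOfCore.exists_memberHullZetaInputs_of_coreInputs`, Kato Thm. 14.5 (2) + Prop. 14.16 (2) re-derived from (b′), (c2′)
and Poitou–Tate), then rkm g13's route-free node `ZetaInputsDescent.katoMemberShaBoundOfReducible_of_newform_of_zetaInputs`.  Twin of the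
K8-t′ glue `reducibleKatoMemberOfCoreInputs_glue` (item 27964, p638767).  HONEST FRAMING: this closes the GLUE item only; the held children
27990 / 27962 / 27963 stay OPEN (cite-level published inputs, no `_holds` expected); crux M is NOT proved unconditionally; nothing is booked;
BSD is not advanced.

References: K. Kato, Astérisque 295 (2004), Thm. 12.5/12.6, Lemma 13.10 (1), Thm. 14.5 (2), (14.9.3), (14.14.1)–(14.14.2), Prop. 14.16 (2),
Lemma 14.18 [Kato2004Asterisque]; C.-H. Kim, AJM 148 §3.2.3 [Kim2022StructureSelmer]; J. S. Milne, *ADT* I Thm. 4.10 [MilneADT2006];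
H. Darmon, CBMS 101 Thm. 3.22 [Darmon2004].
-/

set_option autoImplicit false
-- sibling precedent: the directory name repeats the summit name
set_option linter.dupNamespace false

noncomputable section

namespace Summit.BirchSwinnertonDyer.BirchSwinnertonDyer.Theorems

open Literature.NumberTheory.EllipticCurves Literature.NumberTheory.EllipticCurves.ModularForms
  Literature.NumberTheory.EllipticCurves.Kato2004 Literature.NumberTheory.GaloisCohomology
open Summit.BirchSwinnertonDyer.BirchSwinnertonDyer.Theses.KatoDescentPotSupersingular

/-- **Glue item stmt-BirchSwinnertonDyer-28004 (gen 5; was 27991 at gen 4) on K9, by name**: `ReducibleKatoMemberOfCoreInputs`, i.e.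
`PublishedInputsModularityGZK → PublishedInputMemberHullZetaCore → HeldPoitouTateSelmerDualityQ → PublishedInputMemberHullZetaInputsNamed →
ReducibleKatoMember` (modularity ∧ GZK; Kato's core member package; Poitou–Tate; the aside zeta-package alias is ignored ⟹ crux M).  The aliases
unfold by `rfl`; the composition is `exists_memberHullZetaInputs_of_coreInputs` followed by `katoMemberShaBoundOfReducible_of_newform_of_zetaInputs`.
[cite: Kato2004Asterisque, Thm. 14.5 (2) (p. 236), (14.9.3) (p. 240), (14.14.2) (p. 243), Prop. 14.16 (2) (pp. 244–245), Lemma 14.18 (pp. 247–248)]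
[cite: Kim2022StructureSelmer, §3.2.3] [cite: MilneADT2006, Ch. I, Thm. 4.10 (b)] [cite: Darmon2004, Thm. 3.22] -/
theorem wildReducibleKatoMemberOfCoreInputs_glue :
    Summit.BirchSwinnertonDyer.BirchSwinnertonDyer.Theses.KatoDescentPotSupersingular.ReducibleKatoMemberOfCoreInputs :=
  fun hMG hC hPT _ =>
    ZetaInputsDescent.katoMemberShaBoundOfReducible_of_newform_of_zetaInputs hMG.1
      (MemberHullZetaInputsOfCore.exists_memberHullZetaInputs_of_coreInputs hMG.2 hPT hC)

end Summit.BirchSwinnertonDyer.BirchSwinnertonDyer.Theorems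

end
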